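import Summits.Langlands.Langlands.Theorems.AbelianSurfaceSerreQuadraticImprimitiveSurfacesCliffordIndexTwo
import Literature.NumberTheory.GaloisRepresentations.FramedGaloisRepInduce
import Literature.NumberTheory.GaloisRepresentations.TwistedSumAssembly
import Literature.RepresentationTheory.Semisimple.SubrepresentationEquiv
import HarnessLib

/-!
# Clifford's theorem in index two for framed (Galois) representations: quadratically imprimitive
# ⟹ induced, at the level of characteristic polynomials

Crux `AbelianSurfaceSerre.QuadraticImprimitiveSurfaces` (stmt-Langlands-17766), `--supports` helpers
(companion of `…CliffordIndexTwo.lean`, the abstract part).  Everything here is PROVED: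

* `exists_charpoly_eq_charpoly_comp_indMatrix` — for `r : G →ₜ* GL_n(A)` irreducible over
  a topological field with `r ∘ φ` reducible (`φ : H →ₜ* G` injective, image of index `2`): `n = 2m`
  and there is a continuous IRREDUCIBLE `s : H →ₜ* GL_m(A)` (the frame of the Clifford subspace,
  `ContinuousRep.frame`) with `det(X - r(x)) = det(X - Ind(s)(x))` for every `x ∈ G` and every
  transversal (`indMatrix`; in the adapted basis of `V = U ⊕ r(g₀)U` the matrix of `r(x)` IS the
  induced block matrix, and `charpoly_comp_indMatrix_eq_of_transversal`);
* `exists_charpoly_eq_charpoly_induce_of_not_isIrreducible_restrictField` — for a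
  quadratic extension `L/K` of number fields and `r : Γ_K → GL_n(A)` irreducible with `r|_{Γ_L}`
  reducible: `r` has the characteristic polynomials of `Ind_{Γ_L}^{Γ_K} s` (`FramedGaloisRep.induce`)
  for an irreducible `s : Γ_L → GL_m(A)`, `n = 2m`;
* `exists_rank_two_charpoly_eq_charpoly_induce` — the rank-`4`-over-`ℚ` shape of the
  crux: the card's `ImprimitiveIsInduced` with the irreducibility of `r` as an explicit hypothesis
  (for `(V_p A)^∨` of an abelian surface with `End_ℚ(A) = ℤ` it is Faltings' theorem).

References: A. H. Clifford, Ann. of Math. 38 (1937), Thm. 1 [Clifford1937]; J.-P. Serre, *Linear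
representations of finite groups*, §3.3 Thm. 11–12, §7.3 Prop. 22 [SerreLinearRepresentations1977];
J.-P. Serre, *Abelian ℓ-adic representations* (1968), I §2.1 [SerreAbelianLadic1968].
-/

noncomputable section

open scoped MatrixGroups

set_option linter.dupNamespace false

namespace Summit.Langlands.Langlands.Cruxes.QuadraticImprimitiveSurfaces.Clifford

open Literature.NumberTheory.GaloisRepresentations Field

universe u

/-! ### Framed representations over a topological field -/

section Framed

variable {G H : Type*} [Group G] [TopologicalSpace G] [Group H] [TopologicalSpace H]
  [IsTopologicalGroup H] {A : Type*} [Field A] [TopologicalSpace A] [IsTopologicalRing A] {n : ℕ}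

omit [IsTopologicalGroup H] [IsTopologicalRing A] in
/-- The restriction `r ∘ φ` of a framed representation along a continuous homomorphism has
underlying representation `r.toRepresentation ∘ φ`. [folklore] -/
theorem framedRep_toRepresentation_comp (r : FramedRep G A n) (φ : H →ₜ* G) :
    FramedRep.toRepresentation (r.comp φ) = r.toRepresentation.comp φ.toMonoidHom := rfl

/-- **Clifford, index two, framed form (characteristic polynomials).**  Let `r : G →ₜ* GL_n(A)` be
an irreducible framed representation over a topological field `A`, `φ : H →ₜ* G` an injective
continuous homomorphism whose image has index `2`, and suppose `r ∘ φ` is NOT irreducible.  Then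
`n = 2m` and there is an IRREDUCIBLE framed representation `s : H →ₜ* GL_m(A)` (the action of `H` on
the Clifford subspace `U`, framed by a basis of `U`) such that for every transversal `t` of
`G / φ(H)` and every `x ∈ G`, `det(X - r(x))` is the characteristic polynomial of the induced block
matrix `Ind(s)(x) = (ṡ(tᵢ⁻¹ x tⱼ))ᵢⱼ` (`indMatrix`, flattened by `Matrix.comp`): in the basis
`(u_a, r(g₀)u_a)` of `V = U ⊕ r(g₀)U` (indexed by `Bool × Fin m`) the matrix of `r(x)` IS `Ind(s)(x)`
for the transversal `(1, g₀)`, and the characteristic polynomial does not depend on the transversal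
(`charpoly_comp_indMatrix_eq_of_transversal`).  [cite: Clifford1937, Thm. 1]
[cite: SerreLinearRepresentations1977, §3.3 Thm. 12 (proof), §7.3 Prop. 22] -/
theorem exists_charpoly_eq_charpoly_comp_indMatrix (r : FramedRep G A n)
    (hirr : r.IsIrreducible) (φ : H →ₜ* G) (hinj : Function.Injective φ)
    (hφ : φ.toMonoidHom.range.index = 2) (hred : ¬ FramedRep.IsIrreducible (r.comp φ)) :
    ∃ (m : ℕ) (s : FramedRep H A m), n = 2 * m ∧ s.IsIrreducible ∧
      ∀ {ι : Type*} [Fintype ι] [DecidableEq ι] (t : ι → G),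
        Function.Bijective (fun i => (t i : G ⧸ φ.toMonoidHom.range)) →
        ∀ x : G, FramedRep.charpoly r x =
          (Matrix.comp ι ι (Fin m) (Fin m) A
            (indMatrix φ.toMonoidHom (FramedRep.toMatrixHom s) t x)).charpoly := by
  classical
  set ρ := r.toRepresentation with hρdef
  set N : Subgroup G := φ.toMonoidHom.range with hNdef
  -- Clifford subspace
  obtain ⟨W, hWb, hWt, hW⟩ := exists_isCompl_of_not_isIrreducible_comp ρ hirr
    φ.toMonoidHom hφ (by rwa [← framedRep_toRepresentation_comp])
  -- an element outside `N`
  obtain ⟨g₀, hg₀⟩ : ∃ g : G, g ∉ N := by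
    by_contra! h
    have htop : N = ⊤ := eq_top_iff.mpr fun x _ => h x
    rw [htop, Subgroup.index_top] at hφ
    exact absurd hφ (by norm_num)
  obtain ⟨hinf, hsup⟩ := hW g₀ hg₀
  set U : Submodule A (Fin n → A) := W.toSubmodule with hUdef
  -- the `H`-representation on `U`, continuous for the subspace (= module) topology, and its frame
  haveI : IsModuleTopology A U := TwistedSum.isModuleTopology_submodule_pi U
  let σU : ContinuousRep H A U := ⟨W.toRepresentation, by
    rw [Topology.IsInducing.subtypeVal.continuous_iff]
    change Continuous fun q : H × U =>
      ((r (φ q.1) : GL (Fin n) A) : Matrix (Fin n) (Fin n) A).mulVec (q.2 : Fin n → A)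
    exact ((Units.continuous_val.comp ((map_continuous r).comp
      ((map_continuous φ).comp continuous_fst))).matrix_mulVec
      (continuous_subtype_val.comp continuous_snd))⟩
  set m := Module.finrank A U with hmdef
  let bU : Module.Basis (Fin m) A U := Module.finBasis A U
  let s : FramedRep H A m := σU.frame bU
  have hs_coe : ∀ h : H, ((s h : GL (Fin m) A) : Matrix (Fin m) (Fin m) A) =
      LinearMap.toMatrix bU bU (W.toRepresentation h) := fun h => rfl
  refine ⟨m, s, ?_, ?_, ?_⟩
  · -- `n = 2m`
    have h := finrank_eq_two_mul_of_isCompl_map ρ hinf hsup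
    rwa [Module.finrank_fin_fun] at h
  · -- `s` is irreducible
    haveI : W.toRepresentation.IsIrreducible :=
      isIrreducible_toRepresentation_of_index_two ρ hirr φ.toMonoidHom hφ W hWb hg₀ hinf
    exact Literature.RepresentationTheory.Semisimple.Representation.isIrreducible_of_equiv
      (σU.frameEquiv bU).toRepEquiv.symm
  · -- characteristic polynomials: the adapted basis `B (i, a) = ρ (t₀ i) (bU a)` indexed by
    -- `Bool × Fin m`, for the transversal `t₀ false = 1`, `t₀ true = g₀`
    have hinj' : Function.Injective φ.toMonoidHom := hinj
    have hmul : ∀ {a b : G}, a ∉ N → b ∉ N → a * b ∈ N := fun ha hb =>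
      (Subgroup.mul_mem_iff_of_index_two hφ).mpr (iff_of_false ha hb)
    have hc : IsCompl U (U.map (ρ g₀)) := ⟨disjoint_iff.mpr hinf, codisjoint_iff.mpr hsup⟩
    let eU : U ≃ₗ[A] U.map (ρ g₀) :=
      Submodule.equivMapOfInjective (ρ g₀) (representation_apply_injective ρ g₀) U
    let bU' : Module.Basis (Fin m) A (U.map (ρ g₀)) := bU.map eU
    let B : Module.Basis (Bool × Fin m) A (Fin n → A) :=
      ((bU.prod bU').map (Submodule.prodEquivOfIsCompl _ _ hc)).reindex
        (Equiv.boolProdEquivSum (Fin m)).symm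
    let t₀ : Bool → G := fun c => bif c then g₀ else 1
    have hB : ∀ (i : Bool) (a : Fin m), B (i, a) = ρ (t₀ i) (bU a : Fin n → A) := by
      intro i a
      cases i
      · simp [B, t₀, Module.Basis.reindex_apply, Module.Basis.map_apply, Module.Basis.prod_apply,
          Submodule.coe_prodEquivOfIsCompl']
      · simp [B, t₀, bU', eU, Module.Basis.reindex_apply, Module.Basis.map_apply,
          Module.Basis.prod_apply, Submodule.coe_prodEquivOfIsCompl']
    -- `t₀` is a transversal of `G / N`
    have ht₀ : Function.Bijective (fun i => (t₀ i : G ⧸ N)) := by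
      constructor
      · intro i j hij
        have hij' : (t₀ i)⁻¹ * t₀ j ∈ N := QuotientGroup.eq.mp hij
        cases i <;> cases j
        · rfl
        · exact absurd (by simpa [t₀] using hij') hg₀
        · exfalso
          have : g₀⁻¹ ∈ N := by simpa [t₀] using hij'
          exact hg₀ (by simpa using N.inv_mem this)
        · rfl
      · intro q
        induction q using QuotientGroup.induction_on with
        | H x =>
          by_cases hx : x ∈ N
          · exact ⟨false, QuotientGroup.eq.mpr (by simpa [t₀] using hx)⟩
          · refine ⟨true, QuotientGroup.eq.mpr ?_⟩
            have : g₀⁻¹ ∉ N := fun h => hg₀ (by simpa using N.inv_mem h)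
            simpa [t₀] using hmul this hx
    -- action on the basis vectors of `U`
    have hcol : ∀ (h : H) (b : Fin m),
        ρ (φ h) (bU b : Fin n → A) =
          ∑ c, (LinearMap.toMatrix bU bU (W.toRepresentation h)) c b • (bU c : Fin n → A) := by
      intro h b
      have h1 : W.toRepresentation h (bU b) =
          ∑ c, (LinearMap.toMatrix bU bU (W.toRepresentation h)) c b • bU c := by
        conv_lhs => rw [← Matrix.toLin_toMatrix bU bU (W.toRepresentation h)]
        rw [Matrix.toLin_self]
      have h2 : ρ (φ h) (bU b : Fin n → A) = ((W.toRepresentation h (bU b) : U) : Fin n → A) := rfl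
      rw [h2, h1]
      simp
    -- the matrix of `ρ x` in the basis `B` is the induced block matrix for the transversal `t₀`
    have hmat : ∀ x : G, LinearMap.toMatrix B B (ρ x) =
        Matrix.comp Bool Bool (Fin m) (Fin m) A
          (indMatrix φ.toMonoidHom (FramedRep.toMatrixHom s) t₀ x) := by
      intro x
      ext ⟨i, a⟩ ⟨j, b⟩
      -- the coset of `x t₀ j`
      obtain ⟨i₀, hi₀⟩ := ht₀.2 ((x * t₀ j : G) : G ⧸ N)
      have hmem : (t₀ i₀)⁻¹ * (x * t₀ j) ∈ N := QuotientGroup.eq.mp hi₀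
      obtain ⟨h, hh⟩ := hmem
      have hxB : ρ x (B (j, b)) =
          ∑ c, (LinearMap.toMatrix bU bU (W.toRepresentation h)) c b • B (i₀, c) := by
        rw [hB j b, ← Module.End.mul_apply, ← map_mul,
          show x * t₀ j = t₀ i₀ * φ.toMonoidHom h by rw [hh]; group, map_mul, Module.End.mul_apply,
          show (φ.toMonoidHom h : G) = φ h from rfl, hcol h b, map_sum]
        refine Finset.sum_congr rfl fun c _ => ?_
        rw [map_smul, hB i₀ c]
      rw [LinearMap.toMatrix_apply, hxB, map_sum, Finsupp.finsetSum_apply]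
      simp only [map_smul, Finsupp.smul_apply, Module.Basis.repr_self, Finsupp.single_apply,
        Prod.mk.injEq, smul_eq_mul, mul_ite, mul_one, mul_zero]
      rw [Matrix.comp_apply, indMatrix_apply]
      by_cases hi : i = i₀
      · subst hi
        rw [show (t₀ i)⁻¹ * x * t₀ j = φ.toMonoidHom h by rw [hh, mul_assoc],
          dotExtend_apply_map hinj', FramedRep.toMatrixHom_apply, hs_coe]
        simp [eq_comm]
      · have hnot : (t₀ i)⁻¹ * x * t₀ j ∉ N := by
          intro hin
          apply hi
          apply ht₀.1
          change (t₀ i : G ⧸ N) = (t₀ i₀ : G ⧸ N)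
          have h1 : (t₀ i : G ⧸ N) = (x * t₀ j : G) :=
            QuotientGroup.eq.mpr (by rwa [mul_assoc] at hin)
          have h2 : (t₀ i₀ : G ⧸ N) = (x * t₀ j : G) := hi₀
          exact h1.trans h2.symm
        rw [dotExtend_of_not_mem _ _ hnot, Matrix.zero_apply]
        simp [Ne.symm hi]
    intro ι _ _ t ht x
    rw [charpoly_comp_indMatrix_eq_of_transversal hinj' (FramedRep.toMatrixHom s) ht₀ ht x,
      ← hmat x, LinearMap.charpoly_toMatrix, FramedRep.charpoly_eq_charpoly_toRepresentation]

end Framed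


/-! ### Galois representations: quadratically imprimitive ⟹ induced -/

section Galois

variable (K : Type u) {L : Type*} [Field K] [NumberField K] [Field L] [Algebra K L]
  [FiniteDimensional K L] {A : Type*} [Field A] [TopologicalSpace A] [IsTopologicalRing A] {n : ℕ}

/-- **Clifford's theorem for a quadratic extension of number fields (characteristic polynomials).**
Let `L/K` be quadratic, `r : Γ_K → GL_n(A)` an irreducible framed Galois representation over a
topological field `A` whose restriction `r|_{Γ_L}` (`restrictField`, along the tree's
`absGaloisRestrict K L`) is NOT irreducible.  Then `n = 2m` and there is an irreducible framed
`s : Γ_L → GL_m(A)` with `det(X - r(σ)) = det(X - Ind_{Γ_L}^{Γ_K}(s)(σ))` for every `σ ∈ Γ_K`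
(`FramedGaloisRep.induce`), i.e. `r ≅ Ind_{Γ_L}^{Γ_K} s` at the level of characteristic polynomials —
hence of traces, determinants and Frobenius data.  (`[Γ_K : res Γ_L] = [L : K] = 2`,
`nat_card_quotient_range_absGaloisRestrict`; the chosen transversal of `induce` is immaterial.)
[cite: Clifford1937, Thm. 1] [cite: SerreLinearRepresentations1977, §7.3 Prop. 22, §3.3 Thm. 12] -/
theorem exists_charpoly_eq_charpoly_induce_of_not_isIrreducible_restrictField
    (hd : Module.finrank K L = 2) (r : FramedGaloisRep K A n) (hirr : FramedRep.IsIrreducible r)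
    (hred : ¬ FramedRep.IsIrreducible (r.restrictField L)) :
    ∃ (m : ℕ) (s : FramedGaloisRep L A m), n = 2 * m ∧ FramedRep.IsIrreducible s ∧
      ∀ σ : absoluteGaloisGroup K,
        FramedRep.charpoly r σ = FramedRep.charpoly (s.induce K hd) σ := by
  have hidx : (absGaloisRestrict K L).toMonoidHom.range.index = 2 := by
    rw [← hd]
    exact nat_card_quotient_range_absGaloisRestrict K L
  obtain ⟨m, s, hm, hs, hchar⟩ := exists_charpoly_eq_charpoly_comp_indMatrix r hirr
    (absGaloisRestrict K L) (absGaloisRestrict_injective K L) hidx hred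
  refine ⟨m, s, hm, hs, fun σ => ?_⟩
  rw [FramedGaloisRep.charpoly_induce_eq_charpoly_comp_indMatrix K hd s σ]
  exact hchar (absGaloisCosetRep K L hd) (absGaloisCosetRep_bijective K L hd) σ

end Galois

section RankFour

/-- **Rank four over `ℚ` (the shape used by crux `QuadraticImprimitiveSurfaces`).**  An irreducible
`r : Γ_ℚ → GL₄(A)` which becomes reducible on `Γ_K` for a quadratic number field `K` has the
characteristic polynomials of `Ind_{Γ_K}^{Γ_ℚ} s` for an irreducible `s : Γ_K → GL₂(A)`.  This is
the card's `ImprimitiveIsInduced` with the irreducibility of `r` made an explicit hypothesis (for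
the dual Tate module of an abelian surface with `End_ℚ(A) = ℤ` it is Faltings' theorem).
[cite: Clifford1937, Thm. 1] -/
theorem exists_rank_two_charpoly_eq_charpoly_induce {A : Type} [Field A] [TopologicalSpace A]
    [IsTopologicalRing A] (r : Literature.NumberTheory.GaloisRepresentations.FramedGaloisRep ℚ A 4)
    (hirr : Literature.NumberTheory.GaloisRepresentations.FramedRep.IsIrreducible r) (K : Type)
    [Field K] [NumberField K] (hK : Module.finrank ℚ K = 2)
    (hred : ¬ Literature.NumberTheory.GaloisRepresentations.FramedRep.IsIrreducible
      (r.restrictField K)) :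
    ∃ s : Literature.NumberTheory.GaloisRepresentations.FramedGaloisRep K A 2,
      Literature.NumberTheory.GaloisRepresentations.FramedRep.IsIrreducible s ∧
      ∀ σ : Field.absoluteGaloisGroup ℚ,
        Literature.NumberTheory.GaloisRepresentations.FramedRep.charpoly r σ =
          Literature.NumberTheory.GaloisRepresentations.FramedRep.charpoly (s.induce ℚ hK) σ := by
  obtain ⟨m, s, hm, hs, hchar⟩ :=
    exists_charpoly_eq_charpoly_induce_of_not_isIrreducible_restrictField ℚ hK r
      hirr hred
  obtain rfl : m = 2 := by omega
  exact ⟨s, hs, hchar⟩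

end RankFour


end Summit.Langlands.Langlands.Cruxes.QuadraticImprimitiveSurfaces.Clifford
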